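import Summits.HodgeConjecture.CorCM.Census.OcticTwistMotion

/-!
# The octic twist `(ℤ/8 × B, (4,0))`, III: THE REDUCTION to the residual pair types by descent on `Φ(s₀) + Φ(s₁)`

COR-CM (cell `pub-hodgecm2`), count-neutral kernel combinatorics by the binder seat b09 (gen 33; lane COINVARIANT-TWIST / OCTIC RECON, design
step 2 of the lane note `HOME/pub-hodgecm2-b09/lean-g33/COINVARIANT-TWIST.md` PART C), on top of the pair model (`Census/OcticTwistModel.lean`,
`Census/OcticTwistMotion.lean`: `Ty₂`, `tens`, `hodge₂`, …) and of the quartic Lee potential (`Census/QuarticTwistSquares.lean`: `Phi`, `Phi_tw`, `faceVec`), used BY NAME; the pattern is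
the quartic `Good`-submodule descent of `Census/QuarticTwistReduction.lean`, one dimension up.
Bookkeeping definitions with bodies (`emb₀`, `emb₁`, `pot`, `Covers₂`, `Good₂`) + theorems; no `decide`, no certificate, no named fact,
no `sorry`.  HONEST FRAMING: `HC_CM` is NOT proved, here or anywhere in the tree; nothing here is a period or a headline.

THE REDUCTION (any finite `B`).  Let `N ≤ ℤ^{Ty B × Ty B}` be any submodule (in the application: octic pairs + all motions of the chosen
faces) and `Φ₂(s,t) := Φ(s) + Φ(t)` the OCTIC POTENTIAL (§2, `pot`; invariant under every motion, `pot_act`).  Say `N` COVERS (`Covers₂`, §3)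
if through every pair type `T` with `Φ₂(T) ≥ 2` it contains a four-corner relation `e_T − e_{T₁} − e_{T₂} + e_{T₃}` whose other corners have
smaller `Φ₂` — the three shapes available are written out in §2: a COSET face in coordinate `0` (`cface₀_eq`: `(s;p,q) ⊗ e_t`), in
coordinate `1` (`cface₁_eq`), or a MIXED face (`mface_eq`: `(e_s − e_{s^p}) ⊗ (e_t − e_{t^q})`, the reducing face of an `(atom, atom)` type).
THEN (**`exists_reduced₂`**, strong induction on `Φ₂`, §3) every exponent vector is congruent modulo `N` to one supported on the pair types of
potential `≤ 1` — the RESIDUAL pair types `(cst u, cst u′)`, `(cst, u ± δ_b)`, `(u ± δ_b, cst)` (ten blocks for `|B| ≥ 3`; lane note PART B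
FACT 2).  WHY NOT SLICE BY SLICE: a family with ONE face per octic block, transported by the motions, offers at a type reached from the block
representative by a swap-twist a face in the OTHER coordinate, so the quartic reduction (`Census/QuarticTwistReduction.exists_reduced`) cannot
be run coordinate by coordinate on all slices `{v | v ⊗ e_t ∈ N}` (§1, `emb₀`/`emb₁`, kept for the residual analysis); the descent must follow
the potential with whichever face is available, which is what `Covers₂` records.
What is left for the generation theorem (successor files): (a) one face per non-residual octic block whose motions make `pairs₂ ⊔ span` cover
(`pot_act`: the potential is a block invariant; the quartic `exists_goodSquare` / column faces / mixed squares give the three shapes),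
(b) the residual module on `Φ₂ ≤ 1` (rank `28|B| + 8`, nine `ℤ[G]`-generators `X ⊗ cst`, `w ⊗ cst`, `D`, FACT 3), (c) the count `β − 1` with
the floor of `Census/CoinvariantTwistLaw.lean` (`δ = 0`).

## References
* [Pohlmann1968] H. Pohlmann, Algebraic cycles on abelian varieties of complex multiplication type, Ann. of Math. 88 (1968), Thm 1.
* [Milne1999] J. S. Milne, Lefschetz motives and the Tate conjecture, Compositio Math. 117 (1999), Prop. 2.1, p. 54.
-/

namespace Summit.HodgeConjecture.CorCM.Census.OcticTwist

open Finset
open Summit.HodgeConjecture.CorCM.Census.QuarticTwist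

variable (B : Type) [AddGroup B] [Fintype B] [DecidableEq B]

/-! ## §1 The slice embeddings -/

omit [AddGroup B] [Fintype B] [DecidableEq B] in
/-- `tens` is additive in the first factor. [folklore] -/
theorem tens_add_left (v v' w : Ty B → ℤ) : tens B (v + v') w = tens B v w + tens B v' w := by
  funext T
  show (v T.1 + v' T.1) * w T.2 = v T.1 * w T.2 + v' T.1 * w T.2
  ring

omit [AddGroup B] [Fintype B] [DecidableEq B] in
/-- `tens` is additive in the second factor. [folklore] -/
theorem tens_add_right (v w w' : Ty B → ℤ) : tens B v (w + w') = tens B v w + tens B v w' := by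
  funext T
  show v T.1 * (w T.2 + w' T.2) = v T.1 * w T.2 + v T.1 * w' T.2
  ring

omit [AddGroup B] [Fintype B] [DecidableEq B] in
/-- `tens` is homogeneous in the first factor. [folklore] -/
theorem tens_smul_left (c : ℤ) (v w : Ty B → ℤ) : tens B (c • v) w = c • tens B v w := by
  funext T
  show c * v T.1 * w T.2 = c * (v T.1 * w T.2)
  ring

omit [AddGroup B] [Fintype B] [DecidableEq B] in
/-- `tens` is homogeneous in the second factor. [folklore] -/
theorem tens_smul_right (c : ℤ) (v w : Ty B → ℤ) : tens B v (c • w) = c • tens B v w := by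
  funext T
  show v T.1 * (c * w T.2) = c * (v T.1 * w T.2)
  ring

omit [AddGroup B] [Fintype B] [DecidableEq B] in
/-- `tens` commutes with subtraction in the first factor. [folklore] -/
theorem tens_sub_left (v v' w : Ty B → ℤ) : tens B (v - v') w = tens B v w - tens B v' w := by
  funext T
  show (v T.1 - v' T.1) * w T.2 = v T.1 * w T.2 - v' T.1 * w T.2
  ring

omit [AddGroup B] [Fintype B] [DecidableEq B] in
/-- `tens` commutes with subtraction in the second factor. [folklore] -/
theorem tens_sub_right (v w w' : Ty B → ℤ) : tens B v (w - w') = tens B v w - tens B v w' := by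
  funext T
  show v T.1 * (w T.2 - w' T.2) = v T.1 * w T.2 - v T.1 * w' T.2
  ring

/-- **The slice embedding along the first coordinate**: `emb₀ t v = v ⊗ e_t`. [folklore] -/
def emb₀ (t : Ty B) : (Ty B → ℤ) →ₗ[ℤ] (Ty₂ B → ℤ) where
  toFun v := tens B v (Pi.single t 1)
  map_add' v v' := tens_add_left B v v' _
  map_smul' c v := tens_smul_left B c v _

/-- **The slice embedding along the second coordinate**: `emb₁ s w = e_s ⊗ w`. [folklore] -/
def emb₁ (s : Ty B) : (Ty B → ℤ) →ₗ[ℤ] (Ty₂ B → ℤ) where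
  toFun w := tens B (Pi.single s 1) w
  map_add' w w' := tens_add_right B _ w w'
  map_smul' c w := tens_smul_right B c _ w

omit [AddGroup B] [DecidableEq B] in
/-- `emb₀ t v = v ⊗ e_t`. [folklore] -/
theorem emb₀_apply (t : Ty B) (v : Ty B → ℤ) : emb₀ B t v = tens B v (Pi.single t 1) := rfl

omit [AddGroup B] [DecidableEq B] in
/-- `emb₁ s w = e_s ⊗ w`. [folklore] -/
theorem emb₁_apply (s : Ty B) (w : Ty B → ℤ) : emb₁ B s w = tens B (Pi.single s 1) w := rfl

omit [AddGroup B] [DecidableEq B] in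
/-- The value of `v ⊗ e_t` at a pair type. [folklore] -/
theorem emb₀_apply_apply (t : Ty B) (v : Ty B → ℤ) (T : Ty₂ B) : emb₀ B t v T = if T.2 = t then v T.1 else 0 := by
  show v T.1 * (Pi.single t (1 : ℤ) : Ty B → ℤ) T.2 = _
  rw [Pi.single_apply]
  split_ifs <;> simp

omit [AddGroup B] [DecidableEq B] in
/-- The value of `e_s ⊗ w` at a pair type. [folklore] -/
theorem emb₁_apply_apply (s : Ty B) (w : Ty B → ℤ) (T : Ty₂ B) : emb₁ B s w T = if T.1 = s then w T.2 else 0 := by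
  show (Pi.single s (1 : ℤ) : Ty B → ℤ) T.1 * w T.2 = _
  rw [Pi.single_apply]
  split_ifs <;> simp

omit [AddGroup B] in
/-- **Every exponent vector is the sum of its rows**: `m = Σ_t m(·,t) ⊗ e_t`. [folklore] -/
theorem sum_emb₀_row (m : Ty₂ B → ℤ) : ∑ t, emb₀ B t (fun s => m (s, t)) = m := by
  funext T
  rw [Finset.sum_apply]
  simp only [emb₀_apply_apply]
  rw [Finset.sum_ite_eq univ T.2, if_pos (mem_univ _)]

omit [AddGroup B] in
/-- **Every exponent vector is the sum of its columns**: `m = Σ_s e_s ⊗ m(s,·)`. [folklore] -/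
theorem sum_emb₁_col (m : Ty₂ B → ℤ) : ∑ s, emb₁ B s (fun t => m (s, t)) = m := by
  funext T
  rw [Finset.sum_apply]
  simp only [emb₁_apply_apply]
  rw [Finset.sum_ite_eq univ T.1, if_pos (mem_univ _)]

/-! ## §2 The octic potential and the faces written on their corners -/

/-- **The octic potential** `Φ₂(s,t) = Φ(s) + Φ(t)` (sum of the Lee potentials of the two coordinates). [folklore] -/
def pot (T : Ty₂ B) : ℕ := Phi B T.1 + Phi B T.2

omit [AddGroup B] [DecidableEq B] in
/-- `Φ₂` on a pair. [folklore] -/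
theorem pot_mk (s t : Ty B) : pot B (s, t) = Phi B s + Phi B t := rfl

omit [DecidableEq B] in
/-- **The octic potential is invariant under every motion** (diagonal twists preserve both Lee potentials, the swap-twist exchanges them).
[folklore] -/
theorem pot_act (e : Bool) (h : ZMod 4 × B) (T : Ty₂ B) : pot B (act B e h T) = pot B T := by
  cases e
  · rw [act_false]
    show Phi B (tw B h T.1) + Phi B (tw B h T.2) = Phi B T.1 + Phi B T.2
    rw [Phi_tw, Phi_tw]
  · rw [act_true]
    show Phi B (tw B h (tw B (1, 0) T.2)) + Phi B (tw B h T.1) = Phi B T.1 + Phi B T.2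
    rw [Phi_tw, Phi_tw, Phi_tw, add_comm]

omit [AddGroup B] in
/-- **A coset face in coordinate `0` on its four corners**: `(s; p, q) ⊗ e_t = e_{(s,t)} − e_{(s^p,t)} − e_{(s^q,t)} + e_{(s^{pq},t)}`. [folklore] -/
theorem cface₀_eq (s t : Ty B) (p q : ZMod 2 × B) :
    tens B (faceVec B s p q) (Pi.single t 1) =
      Pi.single (s, t) 1 - Pi.single (QuarticTwist.flip B p s, t) 1 - Pi.single (QuarticTwist.flip B q s, t) 1 +
        Pi.single (QuarticTwist.flip B q (QuarticTwist.flip B p s), t) 1 := by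
  unfold faceVec
  rw [tens_add_left, tens_sub_left, tens_sub_left, single_eq_tens, single_eq_tens, single_eq_tens, single_eq_tens]

omit [AddGroup B] in
/-- **A coset face in coordinate `1` on its four corners**: `e_s ⊗ (t; p, q) = e_{(s,t)} − e_{(s,t^p)} − e_{(s,t^q)} + e_{(s,t^{pq})}`. [folklore] -/
theorem cface₁_eq (s t : Ty B) (p q : ZMod 2 × B) :
    tens B (Pi.single s 1) (faceVec B t p q) =
      Pi.single (s, t) 1 - Pi.single (s, QuarticTwist.flip B p t) 1 - Pi.single (s, QuarticTwist.flip B q t) 1 +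
        Pi.single (s, QuarticTwist.flip B q (QuarticTwist.flip B p t)) 1 := by
  unfold faceVec
  rw [tens_add_right, tens_sub_right, tens_sub_right, single_eq_tens, single_eq_tens, single_eq_tens, single_eq_tens]

omit [AddGroup B] in
/-- **A mixed face on its four corners**: `(e_s − e_{s^p}) ⊗ (e_t − e_{t^q}) = e_{(s,t)} − e_{(s^p,t)} − e_{(s,t^q)} + e_{(s^p,t^q)}`. [folklore] -/
theorem mface_eq (s t : Ty B) (p q : ZMod 2 × B) :
    tens B (Pi.single s 1 - Pi.single (QuarticTwist.flip B p s) 1) (Pi.single t 1 - Pi.single (QuarticTwist.flip B q t) 1) =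
      Pi.single (s, t) 1 - Pi.single (QuarticTwist.flip B p s, t) 1 - Pi.single (s, QuarticTwist.flip B q t) 1 +
        Pi.single (QuarticTwist.flip B p s, QuarticTwist.flip B q t) 1 := by
  rw [tens_sub_sub, single_eq_tens, single_eq_tens, single_eq_tens, single_eq_tens]

/-! ## §3 The reduction by descent on the octic potential -/

/-- **A potential-covering submodule**: through every pair type of octic potential `≥ 2`, `N` contains a four-corner relation
`e_T − e_{T₁} − e_{T₂} + e_{T₃}` whose three other corners have smaller potential (in the application: a motion of the chosen face of
the block of `T` — a coset cross or column square in one coordinate, or a mixed square at an `(atom, atom)` type). [folklore] -/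
def Covers₂ (N : Submodule ℤ (Ty₂ B → ℤ)) : Prop :=
  ∀ T : Ty₂ B, 2 ≤ pot B T → ∃ T₁ T₂ T₃ : Ty₂ B,
    (Pi.single T 1 - Pi.single T₁ 1 - Pi.single T₂ 1 + Pi.single T₃ 1 : Ty₂ B → ℤ) ∈ N ∧
      pot B T₁ < pot B T ∧ pot B T₂ < pot B T ∧ pot B T₃ < pot B T

/-- The vectors congruent modulo `N` to a vector supported on the pair types of potential `≤ 1`
(the RESIDUAL pair types: `(cst u, cst u′)`, `(cst, u ± δ_b)`, `(u ± δ_b, cst)`). [folklore] -/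
def Good₂ (N : Submodule ℤ (Ty₂ B → ℤ)) : Submodule ℤ (Ty₂ B → ℤ) where
  carrier := {m | ∃ r : Ty₂ B → ℤ, m - r ∈ N ∧ ∀ T, r T ≠ 0 → pot B T ≤ 1}
  zero_mem' := ⟨0, by rw [sub_zero]; exact Submodule.zero_mem _, fun T h => (h rfl).elim⟩
  add_mem' := by
    rintro m m' ⟨r, hr, hr'⟩ ⟨r₂, hr₂, hr₂'⟩
    refine ⟨r + r₂, ?_, ?_⟩
    · have e : m + m' - (r + r₂) = (m - r) + (m' - r₂) := by abel
      rw [e]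
      exact Submodule.add_mem _ hr hr₂
    · intro T hT
      rw [Pi.add_apply] at hT
      by_cases h : r T = 0
      · rw [h, zero_add] at hT
        exact hr₂' T hT
      · exact hr' T h
  smul_mem' := by
    rintro c m ⟨r, hr, hr'⟩
    refine ⟨c • r, ?_, ?_⟩
    · rw [← smul_sub]
      exact Submodule.smul_mem _ c hr
    · intro T hT
      rw [Pi.smul_apply, smul_eq_mul] at hT
      exact hr' T fun h => hT (by rw [h, mul_zero])

omit [AddGroup B] [DecidableEq B] in
/-- `N ≤ Good₂ N`. [folklore] -/
theorem le_good₂ (N : Submodule ℤ (Ty₂ B → ℤ)) : N ≤ Good₂ B N :=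
  fun m hm => ⟨0, by rw [sub_zero]; exact hm, fun T h => (h rfl).elim⟩

omit [AddGroup B] [DecidableEq B] in
/-- A unit vector at a pair type of potential `≤ 1` is good. [folklore] -/
theorem single_mem_good₂_of_pot_le (N : Submodule ℤ (Ty₂ B → ℤ)) {T : Ty₂ B} (hT : pot B T ≤ 1) (c : ℤ) :
    Pi.single T c ∈ Good₂ B N := by
  refine ⟨Pi.single T c, by rw [sub_self]; exact Submodule.zero_mem _, fun T' h => ?_⟩
  rw [Pi.single_apply] at h
  by_cases hTT : T' = T
  · rw [hTT]
    exact hT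
  · rw [if_neg hTT] at h
    exact (h rfl).elim

omit [AddGroup B] [DecidableEq B] in
/-- **DESCENT**: if `N` covers, every unit vector is good (strong induction on the octic potential: `e_T` is the relation of `N`
through `T` plus three unit vectors of smaller potential). [folklore] -/
theorem single_mem_good₂ {N : Submodule ℤ (Ty₂ B → ℤ)} (hN : Covers₂ B N) (T : Ty₂ B) : Pi.single T (1 : ℤ) ∈ Good₂ B N := by
  induction hP : pot B T using Nat.strong_induction_on generalizing T with
  | _ n ih =>
  by_cases hle : pot B T ≤ 1
  · exact single_mem_good₂_of_pot_le B N hle 1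
  · obtain ⟨T₁, T₂, T₃, hF, h1, h2, h3⟩ := hN T (by omega)
    have e : (Pi.single T (1 : ℤ) : Ty₂ B → ℤ) =
        (Pi.single T 1 - Pi.single T₁ 1 - Pi.single T₂ 1 + Pi.single T₃ 1) + Pi.single T₁ 1 + Pi.single T₂ 1 - Pi.single T₃ 1 := by
      abel
    rw [e]
    refine Submodule.sub_mem _ (Submodule.add_mem _ (Submodule.add_mem _ (le_good₂ B N hF) ?_) ?_) ?_
    · exact ih (pot B T₁) (by omega) T₁ rfl
    · exact ih (pot B T₂) (by omega) T₂ rfl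
    · exact ih (pot B T₃) (by omega) T₃ rfl

omit [AddGroup B] in
/-- **THE REDUCTION TO THE RESIDUAL PAIR TYPES.**  If `N` covers, every octic exponent vector is congruent modulo `N` to a vector supported
on the pair types of octic potential `≤ 1`. [folklore] -/
theorem exists_reduced₂ {N : Submodule ℤ (Ty₂ B → ℤ)} (hN : Covers₂ B N) (m : Ty₂ B → ℤ) :
    ∃ r : Ty₂ B → ℤ, m - r ∈ N ∧ ∀ T, r T ≠ 0 → pot B T ≤ 1 := by
  suffices h : m ∈ Good₂ B N from h
  have e : m = ∑ T, m T • (Pi.single T (1 : ℤ) : Ty₂ B → ℤ) := by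
    conv_lhs => rw [← Finset.univ_sum_single m]
    refine Finset.sum_congr rfl fun T _ => ?_
    funext T'
    rw [Pi.smul_apply, Pi.single_apply, Pi.single_apply, smul_eq_mul]
    split_ifs <;> simp
  rw [e]
  exact Submodule.sum_mem _ fun T _ => Submodule.smul_mem _ _ (single_mem_good₂ B hN T)

omit [AddGroup B] [DecidableEq B] in
/-- **Covering is inherited by larger submodules.** [folklore] -/
theorem covers₂_mono {N N' : Submodule ℤ (Ty₂ B → ℤ)} (h : N ≤ N') (hN : Covers₂ B N) : Covers₂ B N' := by
  intro T hT
  obtain ⟨T₁, T₂, T₃, hF, h1, h2, h3⟩ := hN T hT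
  exact ⟨T₁, T₂, T₃, h hF, h1, h2, h3⟩

end Summit.HodgeConjecture.CorCM.Census.OcticTwist
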